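import Literature.Computability.Complexity.SymmetricThresholdProgramsRefine
import Literature.Combinatorics.SimpleGraph.OrderedRefinementStable
import HarnessLib

/-!
# Symmetric threshold programs: iterated ordered colour refinement on a wire-given part

Composition of the refinement-round gadget (`SymmetricThresholdProgramsRefine.lean`): `T` rounds
of ORDERED colour refinement on a data-dependent part, all rounds sharing the membership and
adjacency wires, round `r + 1` reading the order/kernel wires produced by round `r`.  The data is
a structure `SymProg.RefineIter P V N T` of raw gate families indexed by the round; `round r`
assembles the `r`-th `RefineRound` gadget from it DEFINITIONALLY, so that all rounds have the same
part and the round theorems apply without transport.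

* `RefineIter.sem_W_iff`, `RefineIter.sem_ltW_iff`, `RefineIter.sem_eqW_iff` — if the initial
  wires read the colouring `col₀` of the part (`Reads₀`), the order/kernel wires entering round
  `r ≤ T` read `ocrIter G col₀ r` (`Literature/Combinatorics/SimpleGraph/OrderedRefinementStable.lean`:
  `(ocrStep G)^[r] col₀`); with `T + 1 ≥ |part|` the last colouring is the stable, EQUITABLE
  refinement (`isEquitable_last`, from `isEquitable_ocrIter`).
This is module T4b of the window canoniser (route `PneNP/SymmetryBudget`, item `NoHiddenOrder`).
Gate count `O(T·(|V|⁴ + |V|³·N))`.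

## References
* J.-Y. Cai, M. Fürer, N. Immerman, Combinatorica 12 (1992), §5 [CaiFurerImmerman1992].
* S. Kiefer, B. D. McKay, *The iteration number of colour refinement*, ICALP 2020, Def. 3
  [KieferMcKay2020].
-/

namespace Literature.Computability.Complexity

open Finset Literature.Combinatorics.SimpleGraph

namespace SymProg

variable {ι Λ : Type*} [DecidableEq ι] [DecidableEq Λ] (P : SymProg ι Λ)
variable (V : Type*) [Fintype V] (N T : ℕ)

/-- **Iterated refinement data**: shared membership/adjacency wires, initial order/kernel wires,
and for every round `r < T` the gate families of a refinement round, whose input order/kernel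
wires are the outputs of the previous round (`ltW`, `eqW` below). [cite: CaiFurerImmerman1992, §5] -/
structure RefineIter where
  /-- membership wire of the part -/
  mem : V → ι ⊕ Λ
  /-- adjacency wire -/
  adj : V → V → ι ⊕ Λ
  /-- initial order wire `[col₀ u < col₀ v]` -/
  lt0 : V → V → ι ⊕ Λ
  /-- initial kernel wire `[col₀ u = col₀ v]` -/
  eq0 : V → V → ι ⊕ Λ
  /-- per round: `c` gates -/
  c : Fin T → V → V → V → Λ
  /-- per round: count comparisons -/
  cmp : Fin T → V → V → V → P.CmpCount N
  /-- `nmem` gates (shared by all rounds) -/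
  nmem : V → Λ
  /-- per round: `nlt` gates -/
  nlt : Fin T → V → V → Λ
  /-- per round: `pre` gates -/
  pre : Fin T → V → V → V → V → Λ
  /-- per round: `allpre` gates -/
  allpre : Fin T → V → V → V → Λ
  /-- per round: `wit` gates -/
  wit : Fin T → V → V → V → Λ
  /-- per round: `prof` gates -/
  prof : Fin T → V → V → Λ
  /-- per round: `tie` gates -/
  tie : Fin T → V → V → Λ
  /-- per round: OUTPUT order gates -/
  ltS : Fin T → V → V → Λ
  /-- per round: OUTPUT kernel gates -/
  eqS : Fin T → V → V → Λ
  c_injective : ∀ r u w, Function.Injective (c r u w)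
  kind_c : ∀ r u w y, P.kind (c r u w y) = Kind.and
  srcs_c : ∀ (r : Fin T) u w y, P.srcs (c r u w y) =
    {mem y, adj u y, (if _h : (r : ℕ) = 0 then eq0 y w else Sum.inr (eqS ⟨r - 1, by omega⟩ y w))}
  cmp_A : ∀ r u v w, (cmp r u v w).A = univ.image fun y => Sum.inr (c r u w y)
  cmp_B : ∀ r u v w, (cmp r u v w).B = univ.image fun y => Sum.inr (c r v w y)
  kind_nmem : ∀ w, P.kind (nmem w) = Kind.nor
  srcs_nmem : ∀ w, P.srcs (nmem w) = {mem w}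
  kind_nlt : ∀ r w' w, P.kind (nlt r w' w) = Kind.nor
  srcs_nlt : ∀ (r : Fin T) w' w, P.srcs (nlt r w' w) =
    {(if _h : (r : ℕ) = 0 then lt0 w' w else Sum.inr (ltS ⟨r - 1, by omega⟩ w' w))}
  kind_pre : ∀ r u v w w', P.kind (pre r u v w w') = Kind.or
  srcs_pre : ∀ r u v w w', P.srcs (pre r u v w w') =
    {Sum.inr (nmem w'), Sum.inr (nlt r w' w), Sum.inr (cmp r u v w').eq}
  kind_allpre : ∀ r u v w, P.kind (allpre r u v w) = Kind.and
  srcs_allpre : ∀ r u v w, P.srcs (allpre r u v w) = univ.image fun w' => Sum.inr (pre r u v w w')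
  kind_wit : ∀ r u v w, P.kind (wit r u v w) = Kind.and
  srcs_wit : ∀ r u v w, P.srcs (wit r u v w) = {mem w, Sum.inr (cmp r u v w).lt, Sum.inr (allpre r u v w)}
  kind_prof : ∀ r u v, P.kind (prof r u v) = Kind.or
  srcs_prof : ∀ r u v, P.srcs (prof r u v) = univ.image fun w => Sum.inr (wit r u v w)
  kind_tie : ∀ r u v, P.kind (tie r u v) = Kind.and
  srcs_tie : ∀ (r : Fin T) u v, P.srcs (tie r u v) =
    {(if _h : (r : ℕ) = 0 then eq0 u v else Sum.inr (eqS ⟨r - 1, by omega⟩ u v)), Sum.inr (prof r u v)}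
  kind_ltS : ∀ r u v, P.kind (ltS r u v) = Kind.or
  srcs_ltS : ∀ (r : Fin T) u v, P.srcs (ltS r u v) =
    {(if _h : (r : ℕ) = 0 then lt0 u v else Sum.inr (ltS ⟨r - 1, by omega⟩ u v)), Sum.inr (tie r u v)}
  kind_eqS : ∀ r u v, P.kind (eqS r u v) = Kind.nor
  srcs_eqS : ∀ r u v, P.srcs (eqS r u v) = {Sum.inr (ltS r u v), Sum.inr (ltS r v u)}

namespace RefineIter

variable {P V N T} (RI : P.RefineIter V N T) (x : ι → Bool)

/-- The order wire entering round `r` (for `r = T`: the final order wire). [folklore] -/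
def ltW (r : Fin (T + 1)) (u v : V) : ι ⊕ Λ :=
  if _h : (r : ℕ) = 0 then RI.lt0 u v else Sum.inr (RI.ltS ⟨r - 1, by omega⟩ u v)

/-- The kernel wire entering round `r` (for `r = T`: the final kernel wire). [folklore] -/
def eqW (r : Fin (T + 1)) (u v : V) : ι ⊕ Λ :=
  if _h : (r : ℕ) = 0 then RI.eq0 u v else Sum.inr (RI.eqS ⟨r - 1, by omega⟩ u v)

/-- The wires entering round `0` are the initial ones. [folklore] -/
theorem ltW_zero (u v : V) : RI.ltW 0 u v = RI.lt0 u v := by simp [ltW]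

/-- The wires entering round `0` are the initial ones. [folklore] -/
theorem eqW_zero (u v : V) : RI.eqW 0 u v = RI.eq0 u v := by simp [eqW]

/-- The wires entering round `r + 1` are the outputs of round `r`. [folklore] -/
theorem ltW_succ (r : Fin T) (u v : V) : RI.ltW r.succ u v = Sum.inr (RI.ltS r u v) := by
  simp only [ltW, Fin.val_succ, Nat.add_one_ne_zero, ↓reduceDIte, Nat.add_one_sub_one, Fin.eta]

/-- The wires entering round `r + 1` are the outputs of round `r`. [folklore] -/
theorem eqW_succ (r : Fin T) (u v : V) : RI.eqW r.succ u v = Sum.inr (RI.eqS r u v) := by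
  simp only [eqW, Fin.val_succ, Nat.add_one_ne_zero, ↓reduceDIte, Nat.add_one_sub_one, Fin.eta]

/-- The `if` in the field equations is `ltW`/`eqW` at `r.castSucc`. [folklore] -/
theorem ltW_castSucc (r : Fin T) (u v : V) :
    RI.ltW r.castSucc u v = (if _h : (r : ℕ) = 0 then RI.lt0 u v else Sum.inr (RI.ltS ⟨r - 1, by omega⟩ u v)) := by
  unfold ltW; simp only [Fin.val_castSucc]

/-- The `if` in the field equations is `ltW`/`eqW` at `r.castSucc`. [folklore] -/
theorem eqW_castSucc (r : Fin T) (u v : V) :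
    RI.eqW r.castSucc u v = (if _h : (r : ℕ) = 0 then RI.eq0 u v else Sum.inr (RI.eqS ⟨r - 1, by omega⟩ u v)) := by
  unfold eqW; simp only [Fin.val_castSucc]

/-- **Round `r` as a refinement-round gadget** (definitionally sharing `mem`, `adj`). [folklore] -/
def round (r : Fin T) : P.RefineRound V N where
  mem := RI.mem
  adj := RI.adj
  lt := RI.ltW r.castSucc
  eq := RI.eqW r.castSucc
  c := RI.c r
  cmp := RI.cmp r
  nmem := RI.nmem
  nlt := RI.nlt r
  pre := RI.pre r
  allpre := RI.allpre r
  wit := RI.wit r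
  prof := RI.prof r
  tie := RI.tie r
  lt' := RI.ltS r
  eq' := RI.eqS r
  c_injective := RI.c_injective r
  kind_c := RI.kind_c r
  srcs_c u w y := by rw [RI.srcs_c, eqW_castSucc]
  cmp_A := RI.cmp_A r
  cmp_B := RI.cmp_B r
  kind_nmem := RI.kind_nmem
  srcs_nmem := RI.srcs_nmem
  kind_nlt := RI.kind_nlt r
  srcs_nlt w' w := by rw [RI.srcs_nlt, ltW_castSucc]
  kind_pre := RI.kind_pre r
  srcs_pre := RI.srcs_pre r
  kind_allpre := RI.kind_allpre r
  srcs_allpre := RI.srcs_allpre r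
  kind_wit := RI.kind_wit r
  srcs_wit := RI.srcs_wit r
  kind_prof := RI.kind_prof r
  srcs_prof := RI.srcs_prof r
  kind_tie := RI.kind_tie r
  srcs_tie u v := by rw [RI.srcs_tie, eqW_castSucc]
  kind_lt' := RI.kind_ltS r
  srcs_lt' u v := by rw [RI.srcs_ltS, ltW_castSucc]
  kind_eq' := RI.kind_eqS r
  srcs_eq' := RI.srcs_eqS r

/-- The part of the iterated data: that of any of its rounds (definitionally). [folklore] -/
def part : Finset V := univ.filter fun u => wval x (P.sem x) (RI.mem u) = true

/-- The rounds have the common part. [folklore] -/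
theorem part_round (r : Fin T) : (RI.round r).part x = RI.part x := rfl

variable {RI x} {G : _root_.SimpleGraph (RI.part x)} [DecidableRel G.Adj] {col₀ : RI.part x → ℕ}

/-- **The initial reading.** [folklore] -/
structure Reads₀ (RI : P.RefineIter V N T) (x : ι → Bool) (G : _root_.SimpleGraph (RI.part x))
    (col₀ : RI.part x → ℕ) : Prop where
  /-- adjacency wires read the graph -/
  adj_iff : ∀ a b : RI.part x, wval x (P.sem x) (RI.adj a b) = true ↔ G.Adj a b
  /-- initial order wires -/
  lt0_iff : ∀ a b : RI.part x, wval x (P.sem x) (RI.lt0 a b) = true ↔ col₀ a < col₀ b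
  /-- initial kernel wires -/
  eq0_iff : ∀ a b : RI.part x, wval x (P.sem x) (RI.eq0 a b) = true ↔ col₀ a = col₀ b

/-- **Round `r` reads the `r`-th iterate** `ocrIter G col₀ r`, for every `r ≤ T`: the order and
kernel wires entering round `r`. [cite: CaiFurerImmerman1992, §5 (vertex refinement)] -/
theorem sem_W_iff (h : Reads₀ RI x G col₀) (hN : (RI.part x).card ≤ N) :
    ∀ (r : ℕ) (hr : r < T + 1) (a b : RI.part x),
      (wval x (P.sem x) (RI.ltW ⟨r, hr⟩ a b) = true ↔ ocrIter G col₀ r a < ocrIter G col₀ r b) ∧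
      (wval x (P.sem x) (RI.eqW ⟨r, hr⟩ a b) = true ↔ ocrIter G col₀ r a = ocrIter G col₀ r b) := by
  intro r
  induction r with
  | zero =>
    intro hr a b
    rw [show (⟨0, hr⟩ : Fin (T + 1)) = 0 from rfl, ltW_zero, eqW_zero, ocrIter_zero]
    exact ⟨h.lt0_iff a b, h.eq0_iff a b⟩
  | succ r ih =>
    intro hr a b
    have hrT : r < T := Nat.lt_of_succ_lt_succ hr
    have hreads : (RI.round ⟨r, hrT⟩).Reads x G (ocrIter G col₀ r) :=
      { adj_iff := h.adj_iff
        lt_iff := fun a' b' => (ih (Nat.lt_of_lt_of_le hrT (Nat.le_succ T)) a' b').1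
        eq_iff := fun a' b' => (ih (Nat.lt_of_lt_of_le hrT (Nat.le_succ T)) a' b').2 }
    have hsucc : (⟨r + 1, hr⟩ : Fin (T + 1)) = (⟨r, hrT⟩ : Fin T).succ := rfl
    rw [hsucc, ltW_succ, eqW_succ, wval_inr, wval_inr, ocrIter_succ]
    exact ⟨RefineRound.sem_lt'_iff hreads hN a b, RefineRound.sem_eq'_iff hreads hN a b⟩

/-- The order wires after `r ≤ T` rounds. [folklore] -/
theorem sem_ltW_iff (h : Reads₀ RI x G col₀) (hN : (RI.part x).card ≤ N) (r : Fin (T + 1))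
    (a b : RI.part x) :
    wval x (P.sem x) (RI.ltW r a b) = true ↔ ocrIter G col₀ r a < ocrIter G col₀ r b :=
  (sem_W_iff h hN r r.2 a b).1

/-- The kernel wires after `r ≤ T` rounds. [folklore] -/
theorem sem_eqW_iff (h : Reads₀ RI x G col₀) (hN : (RI.part x).card ≤ N) (r : Fin (T + 1))
    (a b : RI.part x) :
    wval x (P.sem x) (RI.eqW r a b) = true ↔ ocrIter G col₀ r a = ocrIter G col₀ r b :=
  (sem_W_iff h hN r r.2 a b).2

/-- **After `T + 1 ≥ |part|` rounds the wires read the stable, equitable refinement**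
`ocrIter G col₀ T`. [cite: KieferMcKay2020, Cor. 6] -/
theorem isEquitable_last (hT : (RI.part x).card ≤ T + 1) : IsEquitable G (ocrIter G col₀ T) :=
  isEquitable_ocrIter col₀ (by rw [Fintype.card_coe]; exact hT)

end RefineIter

end SymProg

end Literature.Computability.Complexity
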